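import Summits.ABC.ABC.Theses.CubicResolventAllowance
import Summits.ABC.ABC.Theorems.PlaceCountSzpiroDiscLeJHeight
import Summits.ABC.ABC.Theorems.PlaceCountSzpiroQuadraticTwistClassSzpiro
import Summits.ABC.ABC.Theorems.PlacewiseSzpiroSingleTowerSzpiroMersenneRadical
import Summits.ABC.ABC.Theorems.CubicResolventAllowanceResolventDiscBounds
import HarnessLib

/-!
# STUB-IDEAS `stub_complexCubic` · ideator k1 · generation 3 — typed helper statements

Crux stmt-ABC-22740 `CubicResolventAllowance.IndexSzpiro`, stub `stub_complexCubic` (the `d_K < 0` half).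
FAMILY 1 (recognise & import), gen 3: (A) analogy transfer BY NAME of the tree's Frey–Mersenne calibration
`Summit.ABC.ABC.Theorems.SingleTowerSzpiroLine.radical_mersenne_ge_of_polySzpiroRatEff` to the r = 0,
Δ < 0 class through the PURE-CUBIC MERSENNE FAMILY `E_n : y² = x³ − 6·2ⁿ·x − (2^{3n+1} + 4)`
(2-division field `ℚ(∛2)` for every `n`; `Δ = −2⁸·3³·(2^{3n−1} − 1)²`); (B) rungs that are ALREADY
theorems of the tree (`DiscLeJHeight.minimalDiscriminantNorm_dvd_den_j_mul`,
`QuadraticTwistClassSzpiro.quadraticTwistClass_szpiro_three`).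

Statements only (`sorry` in helper bodies = the proposals; the polynomial identities A1 are kernel-checked).
Nothing here proves the stub; A-PS is NOT abc.
-/

set_option linter.dupNamespace false

noncomputable section

namespace Summit.ABC.ABC.Cruxes.IndexSzpiro.StubIdeasComplexCubic1G3

open Polynomial UniqueFactorizationMonoid
open WeierstrassCurve

/-- The stub, verbatim (payload `stub.signature`; = `IndexSzpiro` with the extra hypothesis `d_K < 0`). -/
def Stub : Prop :=
  ∀ ε : ℝ, 0 < ε → ∃ C : ℝ, ∀ (W : WeierstrassCurve ℚ) [W.IsElliptic] (K : Type) [Field K] [NumberField K],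
    Irreducible W.twoTorsionPolynomial.toPoly → Module.finrank ℚ K = 3 →
    (∃ θ : K, aeval θ W.twoTorsionPolynomial.toPoly = 0) → NumberField.discr K < 0 →
    (W.minimalDiscriminantNorm ℤ : ℝ) ≤ C * |(NumberField.discr K : ℝ)| * (W.conductorNorm ℤ : ℝ) ^ (6 + ε)

/-- The stub's inequality for one curve, one field, constants `(C, ε)`. -/
def Ineq (C ε : ℝ) (W : WeierstrassCurve ℚ) (K : Type) [Field K] [NumberField K] : Prop :=
  (W.minimalDiscriminantNorm ℤ : ℝ) ≤ C * |(NumberField.discr K : ℝ)| * (W.conductorNorm ℤ : ℝ) ^ (6 + ε)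

/-! ## Plan B — rungs that are tree theorems BY NAME (import, ≤ ½ cycle each) -/

/-- B1 (S). Bounded `j`-denominator class: `den(j_W) ≤ B ⇒ Ineq (2⁸·B)` for every `ε > 0` and EVERY
number field `K` (sign-free, `K`-free: uses only `|d_K| ≥ 1`, `N ≥ 1`). Source: tree
`Summit.ABC.ABC.Theorems.DiscLeJHeight.minimalDiscriminantNorm_dvd_den_j_mul`
(`|Δ_min| ∣ 2⁸ · den(j) · N⁵`), `NumberField.discr_ne_zero`, `conductorNorm_pos_holds`. -/
theorem B1_ineq_of_den_j_le (B : ℕ) {ε : ℝ} (hε : 0 < ε) (W : WeierstrassCurve ℚ) [W.IsElliptic]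
    (K : Type) [Field K] [NumberField K] (hden : (W.j).den ≤ B) :
    Ineq (2 ^ 8 * B) ε W K := by
  sorry

/-- B1′ (S). Integral-`j` rung (⊇ `j = 0`, all CM curves, every potentially-good curve): `Ineq 2⁸`. -/
theorem B1'_ineq_of_integral_j {ε : ℝ} (hε : 0 < ε) (W : WeierstrassCurve ℚ) [W.IsElliptic]
    (K : Type) [Field K] [NumberField K] (hj : ∃ z : ℤ, W.j = z) :
    Ineq (2 ^ 8) ε W K := by
  sorry

/-- B2 (S). Twist-class rung schema (constant PER CLASS, not uniform): for every `E₀/ℚ` there is `C(E₀)` with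
`Ineq C(E₀)` on `{W ≅ E₀^{(d)}}` for all `ε > 0`, all `K`. Source: tree
`Summit.ABC.ABC.Theorems.QuadraticTwistClassSzpiro.quadraticTwistClass_szpiro_three`
(`log|Δ_min| ≤ 3 log N + C`), exponentiated. -/
theorem B2_ineq_on_twistClass (W₀ : WeierstrassCurve ℚ) [W₀.IsElliptic] :
    ∃ C : ℝ, ∀ ε : ℝ, 0 < ε → ∀ d : ℚ, d ≠ 0 → ∀ (W : WeierstrassCurve ℚ) [W.IsElliptic]
      (K : Type) [Field K] [NumberField K],
      (∃ e : VariableChange ℚ, e • W = W₀.quadraticTwist d) → Ineq C ε W K := by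
  sorry

/-! ## Plan A — the pure-cubic Mersenne family (analogy transfer of the Frey–Mersenne calibration) -/

/-- A0. The integral model `E_n : y² = x³ − 6·2ⁿ·x − (2^{3n+1} + 4)`; its 2-division cubic is
`4·charpoly(2ⁿ·∛2 + ∛4)`, so its 2-division field is `ℚ(∛2)` for every `n`. -/
def pcmInt (n : ℕ) : WeierstrassCurve ℤ := ⟨0, 0, 0, -(6 * 2 ^ n), -(2 ^ (3 * n + 1) + 4)⟩

/-- A0. `E_n` over `ℚ`. -/
abbrev pcm (n : ℕ) : WeierstrassCurve ℚ := (pcmInt n).baseChange ℚ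

/-- A1 (kernel-checked). `Δ(E_n) = −1728·(2^{3n} − 2)² = −2⁸·3³·(2^{3n−1} − 1)²`. [folklore] -/
theorem A1_Δ (n : ℕ) : (pcmInt n).Δ = -1728 * (2 ^ (3 * n) - 2) ^ 2 := by
  simp only [pcmInt, WeierstrassCurve.Δ, WeierstrassCurve.b₂, WeierstrassCurve.b₄, WeierstrassCurve.b₆,
    WeierstrassCurve.b₈]
  ring

/-- A1 (kernel-checked). `c₄(E_n) = 288·2ⁿ = 2^{n+5}·3²` — the `2ⁿ` of the would-be Frey tower sits in `c₄`
(additive reduction at `2`, `f₂ ≤ 8`), and `p ∤ c₄` for `p ≥ 5`. [folklore] -/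
theorem A1_c₄ (n : ℕ) : (pcmInt n).c₄ = 288 * 2 ^ n := by
  simp only [pcmInt, WeierstrassCurve.c₄, WeierstrassCurve.b₂, WeierstrassCurve.b₄]
  ring

/-- A1′ (kernel-checked). `Δ(E_n/ℚ) = −1728·(2^{3n} − 2)²` (base change of A1). -/
theorem A1_pcm_Δ (n : ℕ) : (pcm n).Δ = -1728 * (2 ^ (3 * n) - 2) ^ 2 := by
  rw [pcm, WeierstrassCurve.baseChange, WeierstrassCurve.map_Δ, A1_Δ, eq_intCast]
  push_cast
  ring

/-- A1″ (kernel-checked). `E_n` is an elliptic curve for every `n` (`2^{3n} ≠ 2`). -/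
theorem A1_isElliptic (n : ℕ) : (pcm n).IsElliptic := by
  refine ⟨?_⟩
  rw [A1_pcm_Δ, isUnit_iff_ne_zero]
  have h : (2 : ℚ) ^ (3 * n) - 2 ≠ 0 := by
    rcases Nat.eq_zero_or_pos n with rfl | hn
    · norm_num
    · have : (2 : ℚ) ^ 3 ≤ 2 ^ (3 * n) := pow_le_pow_right₀ (by norm_num) (by omega)
      intro h0
      have : (2 : ℚ) ^ (3 * n) = 2 := by linarith
      linarith
  positivity

/-- A2 (kernel-checked). Root transport: for any `θ` with `θ³ = 2` (in any `ℚ`-algebra), `β_n = 2ⁿθ + θ²` is a root of the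
2-division cubic of `E_n` (`β³ − 6·2ⁿβ = 2^{3n+1} + 4`). [folklore] -/
theorem A2_root (n : ℕ) {K : Type} [Field K] [Algebra ℚ K] (θ : K) (hθ : θ ^ 3 = 2) :
    aeval ((2 : K) ^ n * θ + θ ^ 2) (pcm n).twoTorsionPolynomial.toPoly = 0 := by
  -- `ψ_{E_n}(2ⁿθ + θ²) = 4·(θ³ − 2)·(θ³ + 3·2ⁿθ² + 3·4ⁿθ + 8ⁿ + 2)`
  simp only [pcm, pcmInt, WeierstrassCurve.baseChange, WeierstrassCurve.map,
    WeierstrassCurve.twoTorsionPolynomial, Cubic.toPoly, WeierstrassCurve.b₂, WeierstrassCurve.b₄,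
    WeierstrassCurve.b₆]
  simp only [map_add, map_mul, map_pow, map_neg, aeval_X, map_ofNat, map_zero]
  linear_combination (4 : K) * (θ ^ 3 + 3 * 2 ^ n * θ ^ 2 + 3 * (2 ^ n) ^ 2 * θ + (2 ^ n) ^ 3 + 2) * hθ

/-- A2′ (S/M). For EVEN `n` the 2-division cubic `4(x³ − 6·2ⁿx − (2^{3n+1}+4))` is irreducible over `ℚ`:
`x³ − 6·2ⁿx − (2^{3n+1}+4)` is Eisenstein at `3` (`8ⁿ ≡ 1 (mod 9)` for even `n`, so the constant term is
`≡ 3 (mod 9)`); Mathlib `Polynomial.IsEisensteinAt.irreducible` + Gauss. [folklore] -/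
theorem A2'_irreducible {n : ℕ} (hn : Even n) : Irreducible (pcm n).twoTorsionPolynomial.toPoly := by
  sorry

/-- A3 (M). For even `n ≥ 2` the model `E_n` is globally minimal (`v₂(Δ) = 8 < 12`, `v₃(Δ) = 3 < 12` since
`3 ∤ 2^{3n−1} − 1` for `3n − 1` odd, and `v_p(c₄) = 0` for `p ≥ 5`), hence
`|Δ_min(E_n)| = 1728·(2^{3n} − 2)² = 2⁸·3³·(2^{3n−1}−1)²`. Tools: tree `minimalDiscriminantNorm_eq_natAbs_holds`,
`exists_ordMinimalDiscriminant_add_eq_padicValInt`, minimality from `ord Δ < 12` / `ord c₄ < 4`. [folklore] -/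
theorem A3_minimalDiscriminantNorm {n : ℕ} (hn : Even n) (h2 : 2 ≤ n) :
    ((pcm n).minimalDiscriminantNorm ℤ : ℤ) = 1728 * (2 ^ (3 * n) - 2) ^ 2 := by
  sorry

/-- A4 (M). Conductor support: for even `n ≥ 2`, `N(E_n) ∣ 2⁸ · 3⁵ · rad(2^{3n−1} − 1)` — `f₂ ≤ 8`, `f₃ ≤ 5`
(tree `conductorExponent_le_eight_holds`, `conductorExponent_le_five_of_natGenerator_eq_three_holds`), and at
`p ≥ 5`, `p ∣ N ⇒ p ∣ Δ ⇒ p ∣ 2^{3n−1} − 1` with `f_p = 1` (`conductorExponent_eq_one_of_dvd_Δ_of_not_dvd_c₄`,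
`p ∤ c₄ = 2^{n+5}3²`); assemble with `conductorNorm_dvd_of_forall_conductorExponent_le`. [folklore] -/
theorem A4_conductorNorm_dvd {n : ℕ} (hn : Even n) (h2 : 2 ≤ n) :
    (pcm n).conductorNorm ℤ ∣ 2 ^ 8 * 3 ^ 5 * radical (mersenne (3 * n - 1)) := by
  sorry

/-- A5a (S/M). A complex cubic field with a cube root of `2` exists (e.g. `AdjoinRoot (X³ − 2)`, Eisenstein at 2;
`finrank = 3` from the power basis). The sign `d_K < 0` is A5b below (or Mathlib's signature-of-discriminant
theorem with `(r₁, r₂) = (1, 1)`). -/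
theorem A5a_exists_pureCubicField :
    ∃ (K : Type) (_ : Field K) (_ : NumberField K), Module.finrank ℚ K = 3 ∧ ∃ θ : K, θ ^ 3 = 2 := by
  sorry

/-- A5b = the SHARED sign dictionary of ideators k1 (H1′), k2 (H1 `SignDictionary`), k3 (H2 `ComplexIffNegDelta`),
in the one direction Plan A needs: a cubic field containing a root of the 2-division cubic of a curve with
`Δ < 0` has `d_K < 0` (`disc(1,θ,θ²) = index²·d_K`, tree `discr_powerBasis_eq_indexDet_sq_mul_discr`;
Mathlib `WeierstrassCurve.twoTorsionPolynomial_discr : disc ψ = 16Δ`). Apply it to `E_n` (`Δ(E_n) < 0`, A1). -/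
def SignDictionaryNeg : Prop :=
  ∀ (W : WeierstrassCurve ℚ) [W.IsElliptic] (K : Type) [Field K] [NumberField K],
    Irreducible W.twoTorsionPolynomial.toPoly → Module.finrank ℚ K = 3 →
    (∃ θ : K, aeval θ W.twoTorsionPolynomial.toPoly = 0) → W.Δ < 0 → NumberField.discr K < 0

/-- A5c (S). The allowance of the family is an ABSOLUTE constant without computing `d_{ℚ(∛2)} = −108`: the
CLOSED support `ResolventDiscBounds` (stmt-ABC-22743, `Summit.ABC.ABC.Theorems.resolventDiscBounds_proof`)
applied to the single curve `E_2` gives `|d_K| ≤ 1944·N(E_2)²` for every cubic field `K` containing `∛2`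
(A2 makes `K` a resolvent field of `E_2`; A2′ irreducibility at `n = 2`). -/
theorem A5c_abs_discr_le (K : Type) [Field K] [NumberField K] (h3 : Module.finrank ℚ K = 3)
    (hθ : ∃ θ : K, θ ^ 3 = 2) :
    |(NumberField.discr K : ℝ)| ≤ 1944 * ((pcm 2).conductorNorm ℤ : ℝ) ^ (2 : ℕ) := by
  sorry

/-- **A6 (M) — the calibration.** The complex stub (indeed its restriction to the ONE field `ℚ(∛2)`) implies an
EXPONENTIAL lower bound for the radical of Mersenne numbers `2^m − 1`, `m = 3n − 1 ≡ 5 (mod 6)`: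
`rad(2^m − 1) ≥ c(ε) · 2^{2m/(6+ε)}`. Proof = the tree's `radical_mersenne_ge_of_polySzpiroRatEff` with the
dictionary Frey `W_n` ↦ `E_n`: from `Stub` get `C`; fix `K ∋ ∛2` (A5a) with `d_K < 0` (A5b+A1) and
`|d_K| ≤ D₀` (A5c); for even `n ≥ 2` feed A2′, `finrank = 3`, A2, `d_K < 0`; then A3 and A4 give
`1728(2^{3n}−2)² ≤ C·D₀·(2⁸3⁵·rad)^{6+ε}`. STATUS of the conclusion: open for every fixed exponent `> 0`
(tree census in `PlacewiseSzpiroSingleTowerSzpiroMersenneRadical.lean`; record Stewart–Yu `rad(2^m−1) ≫ m³/(log m)⁹`,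
[corpus:book:evertse2015 p.88 (4.6.3)]; `abc ⇒ rad(2^m−1) ≫ 2^{(1−ε)m}`). -/
theorem A6_radical_mersenne_ge_of_stub (h : Stub) {ε : ℝ} (hε : 0 < ε) :
    ∃ c : ℝ, 0 < c ∧ ∀ n : ℕ, Even n → 2 ≤ n →
      c * (2 : ℝ) ^ ((2 / (6 + ε)) * ((3 * n - 1 : ℕ) : ℝ)) ≤ ((radical (mersenne (3 * n - 1)) : ℕ) : ℝ) := by
  sorry

/-- A6′ (S, bookkeeping). The same conclusion from the ROUTE CRUX `IndexSzpiro` itself (it implies `Stub`). -/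
theorem A6'_radical_mersenne_ge_of_indexSzpiro
    (h : Summit.ABC.ABC.Theses.CubicResolventAllowance.IndexSzpiro) {ε : ℝ} (hε : 0 < ε) :
    ∃ c : ℝ, 0 < c ∧ ∀ n : ℕ, Even n → 2 ≤ n →
      c * (2 : ℝ) ^ ((2 / (6 + ε)) * ((3 * n - 1 : ℕ) : ℝ)) ≤ ((radical (mersenne (3 * n - 1)) : ℕ) : ℝ) := by
  sorry

/-- Sanity: the route crux gives the stub (drop the sign hypothesis). Kernel-checked. -/
theorem stub_of_indexSzpiro (h : Summit.ABC.ABC.Theses.CubicResolventAllowance.IndexSzpiro) : Stub := by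
  intro ε hε
  obtain ⟨C, hC⟩ := h ε hε
  exact ⟨C, fun W _ K _ _ hirr h3 hθ _ => hC W K hirr h3 hθ⟩

end Summit.ABC.ABC.Cruxes.IndexSzpiro.StubIdeasComplexCubic1G3

end
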